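import Summits.QuantumFields.YangMills.Theorems.BalabanUVNodesPortU8Response9LocUniv
import Summits.QuantumFields.YangMills.Theorems.BalabanUVNodesPortU8LocReceipts
import Summits.QuantumFields.YangMills.Theorems.BalabanUVNodesK0RecordFormatNamesLocE

/-!
# PORT PT-B (U8), g4 file 6 — ★★★ `portPieceLocalityU8_LocUniv`: THE SELECTOR-FREE U8 PACKAGE IN THE SHAPE OF v11-G₄'s CONSEQUENT, ON THE TRANSVERSE TABLE —
# (C1)ᵀ `Response9D` of the whole-torus localized data ∧ (C2a)(C2b)ᵀ the localized chart is `C²` at `0` and vanishes there ∧ (E4a)ᵀ its first derivative on the basis fields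
# IS the tabulated response — from EXACTLY (‴-LocUniv) + (Tok-cmpU-cap); the chart rows are HYPOTHESIS-FREE

Cell `ym-nodeO-ideate` ∕ `ym-balaban-port`, porter `ymgap-nodeO-port-PTB-1` (gen 4).  JOIN-side helper for the decay road of **stmt-QuantumFields-27238** (K0ᴬ),
`--supports stmt-QuantumFields-27238 --as helper` (director-ym №509 (iii′) ∕ №512 ∕ №518: NODE v8 leaf (D) = this lineage's selector-free twin).  The package a planner can
display as the TRANSVERSE re-statement of the U8 row: same binder architecture as `portPieceLocalityU8_v13`'s consequent (`∀ α₂ > 0, ∃ C₉ δ₀, … ∀ k ε₂₉, (∀ a, Response9D …) ∧ ∀ n, …`),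
with `Response9D (recordResponse9DataFromL …) ↦ Response9DAtLocUnivξ` (DEF-1 ed.17 `…K0RecordFormatNamesLocE`: the NAMED receipt on `recordResponse9DataFromLocUnivξ` =
`{ recordResponse9DataFromL … with Gk := fun n => recordGkLocWξ … (K₀+n) Finset.univ a }` by `recordResponse9DataFromLocUnivξ_eq_update`, `rfl`) and
`recordEmbJ ↦ recordEmbLocξ … Finset.univ`, plus the (E4a) receipt (`ResponseRowAtLocξ`, tying the table to the chart's derivative — RowL for the transverse embedding)
which v11-G₄ did not carry.
[I] = [Balaban1987RG1], [15] = [Balaban1985Variational], [B6] = [Balaban1984PropagatorsII].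

WHAT IS PROVED (kernel, sorry-free): ★★★ `portPieceLocalityU8_LocUniv` — assembly (re-keyed to DEF-1's NAMED receipt `Response9DAtLocUnivξ` by the `rfl` face) of ✓`response9D_LocUniv_of_tokens` (g4 file 4), ✓`iotaRowAtLocξ_holds` and ✓`responseRowAtLocξ_holds`
(g4 file 5).  DISPLAYED INPUTS: (‴-LocUniv) and (Tok-cmpU-cap) only (◆ CRIT-1 g35 AUDIT (v) 05:50:28Z: PASS ×2, TRUE-shaped classes, S-wrap-EXEMPT).  Nothing of `recordHr`,
`recordBgField`, `UkSel`, `rootGauge`, Tok-182, TokP9reg occurs.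

HONEST FRAMING.  An implication from displayed token-shaped hypotheses (asserted by nobody); nothing of Bałaban's analysis is asserted ∕ ported ∕ discharged; 27931 CLOSED ·
IMPLICATION-ONLY (unchanged); K0ᴬ 27238 OPEN; NODE O 0∕1; COUNT 8∕28 · K 1∕4 UNMOVED; finite `𝕋⁴_{L^K}` at fixed ε — NOT continuum ∕ OS ∕ Clay;
**the Yang–Mills mass gap (Clay) is NOT proved by any of this.**
-/

noncomputable section

open scoped BigOperators Matrix.Norms.L2Operator

namespace Summit.QuantumFields.YangMills.Theorems.PortU8

open Literature.MathematicalPhysics.QuantumFieldTheory.Balaban1983to89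
open Literature.MathematicalPhysics.QuantumFieldTheory.Balaban1983to89.Node00
open Literature.MathematicalPhysics.QuantumFieldTheory.Balaban1983to89.T4Continuum (T4Family)
open Summit.QuantumFields.YangMills.Theorems.K0RecordFormatNames

variable (F : T4Family)

/-- ★★★ **THE SELECTOR-FREE U8 PACKAGE ON THE TRANSVERSE TABLE** (v11-G₄'s consequent shape, transverse legs): under (‴-LocUniv) and (Tok-cmpU-cap) — both DISPLAYED — for every
`α₂ > 0` there are `C₉ ≥ 0`, `δ₀ > 0` such that for all `k`, `ε₂₉ > 0`: (C1)ᵀ for every colour `a`, `B12FormatPlus.Response9D` (rows R0∕R1ᴰ∕R3∕R4ᴰ∕R5) of the whole-torus localized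
data in the (4.4)-gauge of `recordDom44J … α₂` with window `recordRNat`; and for every member `n`: (C2a)(C2b)ᵀ the chart-unit localized chart `recordEmbLocξ … Finset.univ` is `C²`
at `0` and vanishes there, and (E4a)ᵀ its derivative at `0` on `δ_l ⊗ bV a` IS `recordGkLocWξ … Finset.univ a l` — the last two HYPOTHESIS-FREE.
[cite: Balaban1985Variational, Prop. 9 p.309, (190) p.308; Balaban1987RG1, (1.21) p.264, (4.4)–(4.5) pp.281–282, p.290 L17–20, (4.35) p.290; Balaban1984PropagatorsII, (2.5)–(2.6) p.224, (2.35) p.228] -/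
theorem portPieceLocalityU8_LocUniv (Mc : ℕ) (a₀ : ℝ) (hMc : McGuard F Mc)
    (hL3 : ∃ C₉' δ₉ : ℝ, 0 ≤ C₉' ∧ 0 < δ₉ ∧ ∀ (k n : ℕ) (ε₂₉ : ℝ), 0 < ε₂₉ → letI θ := thetaFill F a₀ ε₂₉; letI := θ.instVβ₁; letI := θ.instVβ₂; letI := θ.instιβ;
      ∀ (a : θ.ιβ) (μ : Fin (F.P (recordK₀ F Mc k + n)).d) (y : Site (F.P (recordK₀ F Mc k + n)) (k + 1)),
      letI Hr : PBond (F.P (recordK₀ F Mc k + n)) 0 → Fin 2 → Fin 2 → ℂ := fun b' => recordHrLocξ F θ k (recordK₀ F Mc k + n) Finset.univ a (μ, y) b';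
      ∀ b : PBond (F.P (recordK₀ F Mc k + n)) 0,
        ‖Hr b‖ ≤ C₉' * (F.P (recordK₀ F Mc k + n)).eta (k + 1) * Real.exp (-(δ₉ * (Site.tdist (coarsenTo (k + 1) b.src) y : ℝ))) ∧
        (∀ ν : Fin (F.P (recordK₀ F Mc k + n)).d, ‖Hr ⟨b.src.shift ν, b.dir⟩ - Hr b‖ ≤ C₉' * (F.P (recordK₀ F Mc k + n)).eta (k + 1) ^ 2 * Real.exp (-(δ₉ * (Site.tdist (coarsenTo (k + 1) b.src) y : ℝ)))) ∧
        ‖∑ ν : Fin (F.P (recordK₀ F Mc k + n)).d, (Hr ⟨b.src.shift ν, b.dir⟩ - (2 : ℂ) • Hr b + Hr ⟨b.src.unshift ν, b.dir⟩)‖ ≤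
          C₉' * (F.P (recordK₀ F Mc k + n)).eta (k + 1) ^ 3 * Real.exp (-(δ₉ * (Site.tdist (coarsenTo (k + 1) b.src) y : ℝ))) ∧
        ‖∑ ν : Fin (F.P (recordK₀ F Mc k + n)).d, ((Hr ⟨b.src, b.dir⟩ + Hr ⟨(b.src).shift b.dir, ν⟩ - Hr ⟨(b.src).shift ν, b.dir⟩ - Hr ⟨b.src, ν⟩) -
          (Hr ⟨b.src.unshift ν, b.dir⟩ + Hr ⟨(b.src.unshift ν).shift b.dir, ν⟩ - Hr ⟨(b.src.unshift ν).shift ν, b.dir⟩ - Hr ⟨b.src.unshift ν, ν⟩))‖ ≤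
          C₉' * (F.P (recordK₀ F Mc k + n)).eta (k + 1) ^ 3 * Real.exp (-(δ₉ * (Site.tdist (coarsenTo (k + 1) b.src) y : ℝ))))
    (hcmp : ∃ C₉' δ₉ : ℝ, 0 ≤ C₉' ∧ 0 < δ₉ ∧ ∀ (k n : ℕ) (ε₂₉ : ℝ), 0 < ε₂₉ → letI θ := thetaFill F a₀ ε₂₉; letI := θ.instVβ₁; letI := θ.instVβ₂; letI := θ.instιβ;
      ∀ (a : θ.ιβ) (μ : Fin (F.P (recordK₀ F Mc k + n)).d) (y : Site (F.P (recordK₀ F Mc k + n)) (k + 1)),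
      ∀ R3 R0 : ℕ, R3 + nestRadius Mc 1 ≤ R0 → 2 * (R0 + 1) < (F.P (recordK₀ F Mc k + n)).sitesPerDir (k + 1) → ∀ z₀ : Fin 4 → ℤ, y ∈ recordWindow F k (recordK₀ F Mc k + n) R3 z₀ →
      letI Hd : PBond (F.P (recordK₀ F Mc k + n)) 0 → Fin 2 → Fin 2 → ℂ := fun b' => recordHrLocξ F θ k (recordK₀ F Mc k + n) Finset.univ a (μ, y) b' -
        recordHrLocξ F θ k (recordK₀ F Mc k + n) (recordWindow F k (recordK₀ F Mc k + n) R0 z₀) a (μ, y) b';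
      ∀ b : PBond (F.P (recordK₀ F Mc k + n)) 0, coarsenTo (k + 1) b.src ∈ recordWindow F k (recordK₀ F Mc k + n) R3 z₀ →
        ‖Hd b‖ ≤ C₉' * (F.P (recordK₀ F Mc k + n)).eta (k + 1) * Real.exp (-(δ₉ * ((R0 : ℝ) - (R3 : ℝ)))) ∧
        (∀ ν : Fin (F.P (recordK₀ F Mc k + n)).d, ‖Hd ⟨b.src.shift ν, b.dir⟩ - Hd b‖ ≤ C₉' * (F.P (recordK₀ F Mc k + n)).eta (k + 1) ^ 2 * Real.exp (-(δ₉ * ((R0 : ℝ) - (R3 : ℝ))))) ∧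
        ‖∑ ν : Fin (F.P (recordK₀ F Mc k + n)).d, (Hd ⟨b.src.shift ν, b.dir⟩ - (2 : ℂ) • Hd b + Hd ⟨b.src.unshift ν, b.dir⟩)‖ ≤
          C₉' * (F.P (recordK₀ F Mc k + n)).eta (k + 1) ^ 3 * Real.exp (-(δ₉ * ((R0 : ℝ) - (R3 : ℝ)))) ∧
        ‖∑ ν : Fin (F.P (recordK₀ F Mc k + n)).d, ((Hd ⟨b.src, b.dir⟩ + Hd ⟨(b.src).shift b.dir, ν⟩ - Hd ⟨(b.src).shift ν, b.dir⟩ - Hd ⟨b.src, ν⟩) -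
          (Hd ⟨b.src.unshift ν, b.dir⟩ + Hd ⟨(b.src.unshift ν).shift b.dir, ν⟩ - Hd ⟨(b.src.unshift ν).shift ν, b.dir⟩ - Hd ⟨b.src.unshift ν, ν⟩))‖ ≤
          C₉' * (F.P (recordK₀ F Mc k + n)).eta (k + 1) ^ 3 * Real.exp (-(δ₉ * ((R0 : ℝ) - (R3 : ℝ)))))
    (α₂ : ℝ) (hα₂ : 0 < α₂) :
    ∃ C₉ δ₀ : ℝ, 0 ≤ C₉ ∧ 0 < δ₀ ∧ ∀ k : ℕ, ∀ ε₂₉ : ℝ, 0 < ε₂₉ →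
      (∀ a : (thetaFill F a₀ ε₂₉).ιβ, Response9DAtLocUnivξ F (thetaFill F a₀ ε₂₉) a Mc k (recordK₀ F Mc k) α₂ C₉ δ₀) ∧
      ∀ n : ℕ, letI θ := thetaFill F a₀ ε₂₉; letI := θ.instVβ₁; letI := θ.instVβ₂;
        (ContDiffAt ℝ 2 (recordEmbLocξ F θ k (recordK₀ F Mc k + n) Finset.univ) 0 ∧ recordEmbLocξ F θ k (recordK₀ F Mc k + n) Finset.univ 0 = 0) ∧
        ∀ a : θ.ιβ, ResponseRowAtLocξ F θ k (recordK₀ F Mc k + n) Finset.univ a := by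
  obtain ⟨C₉, δ₀, hC, hδ, h⟩ := response9D_LocUniv_of_tokens F Mc a₀ hMc hL3 hcmp α₂ hα₂
  refine ⟨C₉, δ₀, hC, hδ, fun k ε₂₉ hε => ⟨fun a => ?_, fun n => ⟨?_, fun a => responseRowAtLocξ_holds F a₀ ε₂₉ k _ Finset.univ a⟩⟩⟩
  · rw [Response9DAtLocUnivξ, recordResponse9DataFromLocUnivξ_eq_update]; exact h k ε₂₉ hε a
  · exact iotaRowAtLocξ_holds F a₀ ε₂₉ k (recordK₀ F Mc k + n) Finset.univ

end Summit.QuantumFields.YangMills.Theorems.PortU8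

end
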